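import Literature.AnabelianGeometry.SemiGraphs.PSCSeparatingCoveringsThreeChainPointed
import Literature.AnabelianGeometry.SemiGraphs.PSCSeparatingCoveringsTwoComponentUnmarkedEdgesOneCusp
import Literature.AnabelianGeometry.SemiGraphs.PSCSeparatingCoveringsClosedSurfaceEdges
import Literature.AnabelianGeometry.SemiGraphs.PSCSeparatingCoveringsBoundaryNode
import Literature.AnabelianGeometry.SemiGraphs.PSCTwoComponentUnmarkedEdges
import HarnessLib

/-!
# [CombGC] Prop. 1.2, proof p. 9: EDGE-LIKE separating coverings at ONE-CUSPED THREE-COMPONENT CHAINS with BOTH END components UNMARKED (row F-2827)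

Mochizuki, *A combinatorial version of the Grothendieck conjecture*, Tohoku Math. J. **59** (2007)
[CombGC], PROOF of Proposition 1.2, author's manuscript p. 9, the resp'd (edge) case
[cite: MochizukiCombGC2007, Prop 1.2 proof p.9]; typed LEVEL-WISE as `PSCDatum.EdgeLikeSeparatingCoverings`
(abc-iut-w4-d081, row P12-L01-E; abc-iut FACT-LIST row F-2827 — a schema whose universal closure is refuted as
typed; the instance forms at genuine carriers are the content).

PROOF-ONLY file (abc-iut-f-166 gen 6, row «BOTH-ENDS-UNMARKED-CHAIN», file 4 = the sub-corner `r = 1` left open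
by file 1; 0 definitions).  The carrier: abc-iut-f-164's three-component chain `C₀ ∪_{ν_A} C_mid ∪_{ν_B} C₁` with
both end components unmarked and a SINGLE marked point, on `C_mid` (`s₁ = 0`, `s₂ = r = 1`, `1 ≤ g₀ ≤ g₁ < g`),
over a profinite pro-`Σ` completion `ι : Γ_{g,1} → Π`.  All three level edge generators are boundary words:
`ε_A = ∏_{i<g₀}[a_i,b_i]`, `η = c_0 ∏_{i<g₁}[a_i,b_i]`, and the lone cusp `c_0 = (∏_i[a_i,b_i])⁻¹`; no second
marked point is available for cusp characters.  Pairs: `ν_A/ν_A` by abc-iut-f-060's node twist; `ν_B/ν_B` by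
abc-iut-f-164's boundary-node theorem for `⟨a_i, b_i : i ≥ g₁⟩`; `c_0/c_0` by the same theorem for `B = Γ_{g,1}`
itself (`θ = id`); cross pairs through `exists_open_separating_of_hom` with Heisenberg quotients mod `ℓ^{[Π:V]}`:
handle-cusp `(a_{i₀}, b_{i₀}, c_0) ↦ (X, Y, Z⁻¹)` at `i₀ = 0` (`ε_A ↦ Z`, `η ↦ 1`) or `i₀ = g₁` (`ε_A ↦ 1`,
`η ↦ Z⁻¹`), and abc-iut-f-164's TWO-HANDLE quotient `(a_0, b_0, a_{g₁}, b_{g₁}) ↦ (X, Y, Y, X)` (kills `c_0`;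
`ε_A, η ↦ Z`).

* `edgeLikeSeparatingCoverings_of_threeChain_unmarkedEnds_oneCusp` — **F-2827** (`V' := V`) at EVERY such datum.

Instance forms at data of the shape of genuine stable curves: consistency evidence for the typed schema, not
the printed theorem for all pointed stable curves.  Nothing here takes a side on [IUTchIII] Cor. 3.12.
-/

noncomputable section

namespace Literature.AnabelianGeometry.SemiGraphs

namespace PSCDatum

open scoped Pointwise
open Multiplicative
open Literature.AnabelianGeometry.Anabelioids (IsSigmaInteger)
open Literature.GroupTheory.CombinatorialGroupTheory
open Literature.GroupTheory.CombinatorialGroupTheory.PuncturedSurfaceGroup (a b c cuspInertia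
  exists_freeGroupBasis_elim_zero exists_hom_closedComponent exists_hom_handle_cusp hom_handle_cusp_nodeLoop
  exists_hom_two_handles hom_two_handles_nodeLoop)
open Literature.GroupTheory.CombinatorialGroupTheory.FreeFactorFibredTwist (mem_closure_range_basis)
open SemiGraphOfAnabelioids (IsProSigmaCompletion)
open SemiGraphOfAnabelioids.IsProSigmaCompletion (nodeTwist_exists_open_separating_sameNode
  boundaryNode_exists_open_separating_sameEdge exists_open_separating_of_hom)

section ThreeChain

variable {P : Type} [Group P] [TopologicalSpace P] [IsTopologicalGroup P]
variable [CompactSpace P] [TotallyDisconnectedSpace P] {Sigma : Set ℕ} {g r : ℕ}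

/-- **Row P12-L01-E / F-2827 (`EdgeLikeSeparatingCoverings`, `V' := V`) at EVERY ONE-CUSPED three-component chain
datum whose two end components are unmarked** (`s₁ = 0`, `s₂ = r = 1`, `1 ≤ g₀ ≤ g₁ < g`).
[cite: MochizukiCombGC2007, Prop 1.2 proof p.9] -/
theorem edgeLikeSeparatingCoverings_of_threeChain_unmarkedEnds_oneCusp (hne : Sigma.Nonempty)
    (hprime : ∀ p ∈ Sigma, p.Prime) (ι : PuncturedSurfaceGroup g r →* P)
    (hι : IsProSigmaCompletion Sigma ι) (G : PSCDatum P) {g₀ g₁ s₁ s₂ : ℕ} (hg₀ : 1 ≤ g₀) (hg : g₀ ≤ g₁)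
    (hg₁ : g₁ < g) (hs₁ : s₁ = 0) (hs₂ : s₂ = r) (hr : r = 1) (e : G.graph.C ≃ Fin r)
    (hC : ∀ c', G.cuspGp c' = ((cuspInertia (g := g) (e c')).map ι).topologicalClosure)
    (εA η : PuncturedSurfaceGroup g r)
    (hεA : εA = ((List.finRange r).map fun j : Fin r =>
          if s₂ ≤ (j : ℕ) then PuncturedSurfaceGroup.c (g := g) j else 1).prod *
        ((List.finRange g).map fun i : Fin g => if (i : ℕ) < g₀ then
          PuncturedSurfaceGroup.a (r := r) i * PuncturedSurfaceGroup.b i *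
            (PuncturedSurfaceGroup.a i)⁻¹ * (PuncturedSurfaceGroup.b i)⁻¹ else 1).prod)
    (hη : η = ((List.finRange r).map fun j : Fin r =>
          if s₁ ≤ (j : ℕ) then PuncturedSurfaceGroup.c (g := g) j else 1).prod *
        ((List.finRange g).map fun i : Fin g => if (i : ℕ) < g₁ then
          PuncturedSurfaceGroup.a (r := r) i * PuncturedSurfaceGroup.b i *
            (PuncturedSurfaceGroup.a i)⁻¹ * (PuncturedSurfaceGroup.b i)⁻¹ else 1).prod)
    (nA nB : G.graph.N) (hN : ∀ n, n = nA ∨ n = nB)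
    (hEA : G.nodeGp nA = ((Subgroup.zpowers εA).map ι).topologicalClosure)
    (hEB : G.nodeGp nB = ((Subgroup.zpowers η).map ι).topologicalClosure) :
    G.EdgeLikeSeparatingCoverings := by
  classical
  subst hs₁
  subst s₂
  subst hr
  obtain ⟨g₂, rfl⟩ : ∃ g₂, g = g₁ + g₂ := ⟨g - g₁, by omega⟩
  have hg₂ : 1 ≤ g₂ := by omega
  obtain ⟨ℓ, hℓS⟩ := hne
  have hℓ : ℓ.Prime := hprime ℓ hℓS
  -- the `c₀`-eliminating basis (all handle letters), the closed component `⟨a_i, b_i : i ≥ g₁⟩`, and `Γ` itself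
  obtain ⟨b₀, ha, hb, -⟩ := exists_freeGroupBasis_elim_zero (g₁ + g₂) 0
  obtain ⟨θ, hθinj, -, -, hθc, hθrange⟩ := exists_hom_closedComponent (g₀ := g₁) (g₁ := g₂) (r' := 0) η hη
  obtain ⟨S_B, hS_B⟩ : ∃ S : Set ((Fin (g₁ + g₂) × Bool) ⊕ Fin 0),
      S = {x | Sum.elim (fun p : Fin (g₁ + g₂) × Bool => g₁ ≤ (p.1 : ℕ)) (fun _ : Fin 0 => False) x} :=
    ⟨_, rfl⟩
  have hθB : θ.range = Subgroup.closure (b₀ '' S_B) := by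
    rw [hθrange, hS_B]
    congr 1
    ext x
    constructor
    · rintro ⟨i, hi, rfl | rfl⟩
      · exact ⟨Sum.inl (i, false), hi, ha i⟩
      · exact ⟨Sum.inl (i, true), hi, hb i⟩
    · rintro ⟨y, hy, rfl⟩
      rcases y with ⟨i, _ | _⟩ | j
      · exact ⟨i, hy, Or.inl (ha i)⟩
      · exact ⟨i, hy, Or.inr (hb i)⟩
      · exact j.elim0
  have hidB : (MonoidHom.id (PuncturedSurfaceGroup (g₁ + g₂) 1)).range = Subgroup.closure (b₀ '' Set.univ) := by
    ext x
    exact ⟨fun _ => by rw [Set.image_univ]; exact mem_closure_range_basis b₀ x, fun _ => ⟨x, rfl⟩⟩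
  -- `ε_A` is the closed-surface loop `∏_{i<g₀}[a_i,b_i]`
  have hcusp1 : ((List.finRange 1).map fun j : Fin 1 =>
      if 1 ≤ (j : ℕ) then PuncturedSurfaceGroup.c (g := g₁ + g₂) j else 1).prod = 1 :=
    List.prod_eq_one fun y hy => by
      obtain ⟨j, -, rfl⟩ := List.mem_map.mp hy
      exact if_neg (by omega)
  have hεx : εA = ((List.finRange (g₁ + g₂)).map fun i : Fin (g₁ + g₂) => if (i : ℕ) < g₀ then
      a (r := 1) i * b i * (a i)⁻¹ * (b i)⁻¹ else 1).prod := by rw [hεA, hcusp1, one_mul]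
  -- the edge groups
  have hc0 : ∀ c', e c' = 0 := fun c' => Fin.fin_one_eq_zero (e c')
  obtain ⟨xs, hxs⟩ : ∃ f : G.graph.N → PuncturedSurfaceGroup (g₁ + g₂) 1,
      f = fun n => if n = nA then εA else η := ⟨_, rfl⟩
  have hxA : ∀ n, n = nA → xs n = εA := fun n hn => by rw [hxs]; exact if_pos hn
  have hxB : ∀ n, n ≠ nA → xs n = η := fun n hn => by rw [hxs]; exact if_neg hn
  have hEn : ∀ n, G.edgeGp (Sum.inl n) = ((Subgroup.zpowers (xs n)).map ι).topologicalClosure := by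
    intro n
    change G.nodeGp n = _
    by_cases hn : n = nA
    · rw [hxA n hn, hn, hEA]
    · rcases hN n with h | h
      · exact absurd h hn
      · rw [hxB n hn, h, hEB]
  have hEc : ∀ c', G.edgeGp (Sum.inr c') = ((Subgroup.zpowers (c 0)).map ι).topologicalClosure :=
    fun c' => by rw [show G.edgeGp (Sum.inr c') = G.cuspGp c' from rfl, hC c', hc0 c']; rfl
  have hEnA : ∀ n, n = nA → G.edgeGp (Sum.inl n) = ((Subgroup.zpowers (((List.finRange (g₁ + g₂)).map
      fun i : Fin (g₁ + g₂) => if (i : ℕ) < g₀ then a (r := 1) i * b i * (a i)⁻¹ * (b i)⁻¹ else 1).prod)).map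
        ι).topologicalClosure := fun n hn => by rw [hEn n, hxA n hn, hεx]
  have hEnB : ∀ n, n ≠ nA → G.edgeGp (Sum.inl n) =
      ((Subgroup.zpowers (θ (c 0))).map ι).topologicalClosure := fun n hn => by
    rw [hEn n, hxB n hn, hθc]
  have hιn : ∀ n, ι (xs n) ∈ G.edgeGp (Sum.inl n) := fun n => by
    rw [hEn]
    exact Subgroup.le_topologicalClosure _ (Subgroup.mem_map_of_mem ι (Subgroup.mem_zpowers _))
  have hιc : ∀ c', ι (c 0) ∈ G.edgeGp (Sum.inr c') := fun c' => by
    rw [hEc]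
    exact Subgroup.le_topologicalClosure _ (Subgroup.mem_map_of_mem ι (Subgroup.mem_zpowers _))
  intro V hVn hVo
  haveI := hVn
  refine ⟨V, hVn, hVo, le_rfl, ?_⟩
  -- the finite `Σ`-targets mod `ℓ^m`, `m = [Π : V]`
  have hVi : IsSigmaInteger Sigma V.index := hι.index_open V hVn hVo
  obtain ⟨m, hm⟩ : ∃ m : ℕ, m = V.index := ⟨_, rfl⟩
  have hmpos : 0 < m := by rw [hm]; exact hVi.1
  have hfin : ∀ {M : Type} [Group M] (u : M), u ^ m ≠ 1 → u ^ V.index ≠ 1 := fun u h => by rwa [← hm]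
  have hmlt : m < ℓ ^ m := Nat.lt_pow_self hℓ.one_lt
  haveI : NeZero (ℓ ^ m) := ⟨pow_ne_zero _ hℓ.ne_zero⟩
  obtain ⟨φH, X, Y, Z, hXYZ, hZc, hZpow, hcard⟩ := Heisenberg.exists_heisenbergTriple_central (ℓ ^ m)
  haveI : Finite (Multiplicative (ZMod (ℓ ^ m) × ZMod (ℓ ^ m)) ⋊[φH] Multiplicative (ZMod (ℓ ^ m))) :=
    Nat.finite_of_card_ne_zero (by rw [hcard]; exact pow_ne_zero _ (pow_ne_zero _ hℓ.ne_zero))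
  have hHM : IsSigmaInteger Sigma
      (Nat.card (Multiplicative (ZMod (ℓ ^ m) × ZMod (ℓ ^ m)) ⋊[φH] Multiplicative (ZMod (ℓ ^ m)))) := by
    rw [hcard, ← pow_mul]
    exact Literature.AnabelianGeometry.SemiGraphs.isSigmaInteger_prime_pow hℓ hℓS _
  have hZm : Z ^ m ≠ 1 := fun h => absurd (Nat.le_of_dvd hmpos ((hZpow m).mp h)) (not_le.mpr hmlt)
  have hZm' : Z⁻¹ ^ m ≠ 1 := by rw [inv_pow]; exact inv_ne_one.mpr hZm
  have hW : X * Y * X⁻¹ * Y⁻¹ * Z⁻¹ = 1 := by rw [hXYZ, mul_inv_cancel]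
  have hZc' : X * Y * X⁻¹ * Y⁻¹ ∈ Subgroup.center _ := by rw [hXYZ]; exact hZc
  -- Heisenberg handle-cusp certificates: handle `i₀`, the cusp `c_0 ↦ Z⁻¹`
  have hheis : ∀ i₀ : Fin (g₁ + g₂),
      ∃ ψ : PuncturedSurfaceGroup (g₁ + g₂) 1 →*
        Multiplicative (ZMod (ℓ ^ m) × ZMod (ℓ ^ m)) ⋊[φH] Multiplicative (ZMod (ℓ ^ m)),
        ψ (c 0) = Z⁻¹ ∧ ψ εA = (if (i₀ : ℕ) < g₀ then Z else 1) ∧ ψ η = Z⁻¹ * (if (i₀ : ℕ) < g₁ then Z else 1) := by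
    intro i₀
    obtain ⟨ψ, ha', hb', hc', hab, hcj⟩ := exists_hom_handle_cusp (g := g₁ + g₂) (r := 1) i₀ 0 X Y Z⁻¹ hW
    refine ⟨ψ, hc', ?_, ?_⟩
    · rw [hεA, hom_handle_cusp_nodeLoop ψ ha' hb' hc' hab hcj g₀ 1, if_neg (by simp), one_mul, hXYZ]
    · rw [hη, hom_handle_cusp_nodeLoop ψ ha' hb' hc' hab hcj g₁ 0, if_pos (Nat.zero_le _), hXYZ]
  -- the two-handle certificate `(a_0, b_0, a_{g₁}, b_{g₁}) ↦ (X, Y, Y, X)`: kills `c_0`, `ε_A, η ↦ Z`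
  have h0g₀ : ((⟨0, by omega⟩ : Fin (g₁ + g₂)) : ℕ) < g₀ := by simp only; omega
  have h0g₁ : ((⟨0, by omega⟩ : Fin (g₁ + g₂)) : ℕ) < g₁ := by simp only; omega
  have hi₁ : ¬ ((⟨g₁, by omega⟩ : Fin (g₁ + g₂)) : ℕ) < g₁ := lt_irrefl _
  have hi₁' : ¬ ((⟨g₁, by omega⟩ : Fin (g₁ + g₂)) : ℕ) < g₀ := by simp only; omega
  obtain ⟨ψ₂, ha₂, hb₂, -, -, hab₂, hcj₂⟩ := exists_hom_two_handles (g := g₁ + g₂) (r := 1) ⟨0, by omega⟩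
    ⟨g₁, by omega⟩ (fun h => by have := congrArg Fin.val h; simp only at this; omega) X Y hZc'
  have hψ₂A : ψ₂ εA = Z := by
    rw [hεA, hom_two_handles_nodeLoop ψ₂ ha₂ hb₂ hab₂ hcj₂ g₀ 1 h0g₀ (by simp only; omega), hXYZ]
  have hψ₂B : ψ₂ η = Z := by
    rw [hη, hom_two_handles_nodeLoop ψ₂ ha₂ hb₂ hab₂ hcj₂ g₁ 0 h0g₁ (by simp only; exact le_rfl), hXYZ]
  have hkill : ∀ {M : Type} [Group M] (φ : PuncturedSurfaceGroup (g₁ + g₂) 1 →* M)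
      (z : PuncturedSurfaceGroup (g₁ + g₂) 1), φ z = 1 → ∀ x ∈ Subgroup.zpowers z, φ x = 1 := by
    intro M _ φ z hz x hx
    obtain ⟨t, rfl⟩ := Subgroup.mem_zpowers_iff.mp hx
    rw [map_zpow, hz, one_zpow]
  rintro (n₁ | c₁) (n₂ | c₂) γ₁ γ₂ hne12
  · -- node / node
    by_cases h12 : n₁ = n₂
    · subst h12
      have hne' := hne12.resolve_left fun h => h rfl
      by_cases h1 : n₁ = nA
      · -- `ν_A / ν_A`: abc-iut-f-060's node twist
        have hA := hEnA n₁ h1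
        exact nodeTwist_exists_open_separating_sameNode hι hg₀ (by omega) _ rfl hℓ hℓS (G.edgeGp (Sum.inl n₁))
          hA V hVo γ₁ γ₂ hne'
      · -- `ν_B / ν_B`: abc-iut-f-164's boundary-node theorem for `⟨a_i, b_i : i ≥ g₁⟩`
        exact boundaryNode_exists_open_separating_sameEdge hι b₀ S_B _ rfl hg₂ θ hθinj hθB hℓ hℓS
          (G.edgeGp (Sum.inl n₁)) (hEnB n₁ h1) V hVo γ₁ γ₂ hne'
    · by_cases h1 : n₁ = nA
      · -- alive `ε_A`, killed `η`: Heisenberg at the handle `0`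
        have h2 : n₂ ≠ nA := fun h => h12 (h1.trans h.symm)
        obtain ⟨ψ, -, hψA, hψB⟩ := hheis ⟨0, by omega⟩
        refine exists_open_separating_of_hom hι hHM ψ (G.edgeGp (Sum.inl n₂)) (Subgroup.zpowers (xs n₂))
          (hEn n₂) (hkill ψ _ ?_) (G.edgeGp (Sum.inl n₁)) (xs n₁) (hιn n₁) V hVo ?_ γ₁ γ₂
        · rw [hxB n₂ h2, hψB, if_pos h0g₁, inv_mul_cancel]
        · rw [hxA n₁ h1, hψA, if_pos h0g₀]
          exact hfin _ hZm
      · -- alive `η`, killed `ε_A`: Heisenberg at the handle `g₁`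
        have h2 : n₂ = nA := by
          rcases hN n₂ with h | h
          · exact h
          · rcases hN n₁ with h' | h'
            · exact absurd h' h1
            · exact absurd (h'.trans h.symm) h12
        obtain ⟨ψ, -, hψA, hψB⟩ := hheis ⟨g₁, by omega⟩
        refine exists_open_separating_of_hom hι hHM ψ (G.edgeGp (Sum.inl n₂)) (Subgroup.zpowers (xs n₂))
          (hEn n₂) (hkill ψ _ (by rw [hxA n₂ h2, hψA, if_neg hi₁'])) (G.edgeGp (Sum.inl n₁)) (xs n₁) (hιn n₁)
          V hVo ?_ γ₁ γ₂
        rw [hxB n₁ h1, hψB, if_neg hi₁, mul_one]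
        exact hfin _ hZm'
  · -- alive: a node; killed: the cusp `c_0` — the two-handle certificate
    refine exists_open_separating_of_hom hι hHM ψ₂ (G.edgeGp (Sum.inr c₂)) (Subgroup.zpowers (c 0)) (hEc c₂)
      (hkill ψ₂ _ (hcj₂ 0)) (G.edgeGp (Sum.inl n₁)) (xs n₁) (hιn n₁) V hVo ?_ γ₁ γ₂
    by_cases h1 : n₁ = nA
    · rw [hxA n₁ h1, hψ₂A]; exact hfin _ hZm
    · rw [hxB n₁ h1, hψ₂B]; exact hfin _ hZm
  · -- alive: the cusp `c_0`; killed: a node — Heisenberg at the handle `g₁` (kills `ε_A`) resp. `0` (kills `η`)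
    by_cases h2 : n₂ = nA
    · obtain ⟨ψ, hψk, hψA, -⟩ := hheis ⟨g₁, by omega⟩
      exact exists_open_separating_of_hom hι hHM ψ (G.edgeGp (Sum.inl n₂)) (Subgroup.zpowers (xs n₂))
        (hEn n₂) (hkill ψ _ (by rw [hxA n₂ h2, hψA, if_neg hi₁'])) (G.edgeGp (Sum.inr c₁)) (c 0) (hιc c₁) V hVo
        (by rw [hψk]; exact hfin _ hZm') γ₁ γ₂
    · obtain ⟨ψ, hψk, -, hψB⟩ := hheis ⟨0, by omega⟩
      refine exists_open_separating_of_hom hι hHM ψ (G.edgeGp (Sum.inl n₂)) (Subgroup.zpowers (xs n₂))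
        (hEn n₂) (hkill ψ _ ?_) (G.edgeGp (Sum.inr c₁)) (c 0) (hιc c₁) V hVo (by rw [hψk]; exact hfin _ hZm')
        γ₁ γ₂
      rw [hxB n₂ h2, hψB, if_pos h0g₁, inv_mul_cancel]
  · -- cusp / cusp: the lone cusp, `c₁ = c₂`; boundary-node theorem for `B = Γ_{g,1}` (`θ = id`)
    have h12 : c₁ = c₂ := e.injective (by rw [hc0, hc0])
    subst h12
    have hne' := hne12.resolve_left fun h => h rfl
    exact boundaryNode_exists_open_separating_sameEdge hι b₀ Set.univ _ rfl (by omega)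
      (MonoidHom.id (PuncturedSurfaceGroup (g₁ + g₂) 1)) Function.injective_id hidB hℓ hℓS
      (G.edgeGp (Sum.inr c₁)) (by rw [MonoidHom.id_apply]; exact hEc c₁) V hVo γ₁ γ₂ hne'

end ThreeChain

end PSCDatum

end Literature.AnabelianGeometry.SemiGraphs

end
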